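import Mathlib

/-!
# The inner cone system in Lemma-8.22 variables and the slow-manifold energy identity (K37)

Solo seat `solo-NavierStokesRegularity-informed`, session 16; companion of `paper/axisymmetric-rigidity.md` §5l, LEMMA 8.34.
Inner variables of a smooth swirling cone `(z₁, σ)`: `ε = sin² z₁/σ²`, inner time `t`, `S = sin(√ε t)/√ε`, `C = cos(√ε t)`
(`S' = C`, `C' = -ε S`, `ε S² + C² = 1`), `K = C/S`; cone unknowns `(u, V, s)` with the pressure eliminated by the first
integral (K35): `V u' = 2 s (s - S) + 2 ε V²`, `V' = -3u - V K`, `V s' = -s (1 + 2u + V K)`.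
With `W := -V S` (`> 0` on the polar sector), `U := 1 + 2u + 2 V K` and
`Y := 2s² - 2sS + U²/4 + U W C/S² - (3/2) W C/S² + W²/S⁴` (Lemma 8.22's fast partner, p-free inner form) the system closes as
* `innerWUs_W`:  `W' = 3 W C/S + (3S/2)(U - 1)`;
* `innerWUs_U`:  `U' = 3C/S - 2W/S³ - 3 U C/S - 4 S s (s - S)/W`  (stated multiplied by `V S²`; `(C/S)' = -1/S²`);
* `innerWUs_s`:  `s' = s (U S/W + C/S)`  (stated multiplied by `V`);
* `innerGt_deriv`: the slow forcing `G̃ := 3C/S - 2W/S³` has `G̃' = -3U/S²` (stated multiplied by `S⁶`);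
* `innerU_Yform`: `U' = -2 Y S/W - U C/S + U² S/(2W)`;
* `innerY_deriv`:  `Y' = 2 s² U S/W - (3/2) ε W/S + ε U W/S - (3/2) W C²/S³ - (9/4)(U - 1) C/S`;
* `innerEnergy_identity` (LEMMA 8.34): for ANY comparison values `(Uc, Yc, sc)` with ANY assigned rates `(gU, gY)`,
  `d/dt [s²(U-Uc)² + (Y-Yc)²] = s² S (3U+Uc)(U-Uc)²/W + 2(Y-Yc)(U-Uc)(εW/S - (9/4)C/S) + 4 S Uc (s²-sc²)(Y-Yc)/W
   - 2 s² (U-Uc) ρ_U - 2 (Y-Yc) ρ_Y`, `ρ_U := gU - F_U(Uc,Yc)`, `ρ_Y := gY - F_Y(Uc,sc)`: the cross terms and the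
  adiabatic term `± 2 s² (C/S)(U-Uc)²` cancel exactly, whatever the graph;
* `slowManifold_Dr`: the first slaving step: `r := W G̃/(4S³)` has slaved derivative `∂_t r + (3WC/S - 3S/2) ∂_W r = -3 G̃/(8 S²)`;
* `slowW_solves`: `W_sl := (3/2) S² (C - η S)` solves `W' = 3WC/S - 3S/2` (the `U = 0` flux through the cone point `C/S = η`).
All statements are identities between real numbers (derivative values enter as hypotheses); no new definitions; axioms: standard.
-/

namespace Summit.NavierStokesRegularity.NavierStokesRegularity.Theorems

/-- `W := -V S` obeys `W' = 3WC/S + (3S/2)(U-1)` with `U := 1 + 2u + 2VK`, `K = C/S`, `S' = C = K S`. -/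
theorem innerWUs_W (u V S K dV : ℝ) (hdV : dV = -3 * u - V * K) :
    -(dV * S + V * (K * S)) = 3 * (-(V * S)) * K + 3 / 2 * S * ((1 + 2 * u + 2 * V * K) - 1) := by
  subst hdV; ring

/-- `U := 1 + 2u + 2VK` obeys `V S² U' = 3 K V S² + 2 V² - 3 U K V S² + 4 S² s (s - S)`, i.e. (dividing by `V S²`, `W = -VS`)
`U' = 3C/S - 2W/S³ - 3UC/S - 4 S s (s-S)/W`; inputs: the p-free strain equation, `V' = -3u - VK`, `(C/S)' = -1/S²`. -/
theorem innerWUs_U (u V s S C K ε du dV dK : ℝ) (hK : K * S = C) (hPy : ε * S ^ 2 + C ^ 2 = 1)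
    (hdu : V * du = 2 * s * (s - S) + 2 * ε * V ^ 2) (hdV : dV = -3 * u - V * K) (hdK : S ^ 2 * dK = -1) :
    V * S ^ 2 * (2 * du + 2 * dV * K + 2 * V * dK)
      = 3 * K * V * S ^ 2 + 2 * V ^ 2 - 3 * (1 + 2 * u + 2 * V * K) * K * V * S ^ 2 + 4 * S ^ 2 * s * (s - S) := by
  linear_combination (2 * S ^ 2) * hdu + (2 * K * V * S ^ 2) * hdV + (2 * V ^ 2) * hdK + (4 * V ^ 2) * hPy
    + (4 * V ^ 2 * (K * S + C)) * hK

/-- The swirl equation in `(W, U)` form: `V s' = s (K V - U)`, i.e. `s' = s (U S/W + C/S)`. -/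
theorem innerWUs_s (u V s K ds : ℝ) (hds : V * ds = -s * (1 + 2 * u + V * K)) :
    V * ds = s * (K * V - (1 + 2 * u + 2 * V * K)) := by
  linear_combination hds

/-- The slow forcing `G̃ := 3C/S - 2W/S³` obeys `G̃' = -3U/S²` (multiplied by `S⁶`). -/
theorem innerGt_deriv (W U S C ε dS dC dW : ℝ) (hPy : ε * S ^ 2 + C ^ 2 = 1) (hdS : dS = C) (hdC : dC = -ε * S)
    (hdW : S * dW = 3 * W * C + 3 / 2 * S ^ 2 * (U - 1)) :
    3 * (dC * S - C * dS) * S ^ 4 - 2 * (dW * S ^ 3 - 3 * W * S ^ 2 * dS) = -3 * U * S ^ 4 := by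
  linear_combination (3 * S ^ 5) * hdC + (-3 * C * S ^ 4 + 6 * W * S ^ 2) * hdS + (-2 * S ^ 2) * hdW + (-3 * S ^ 4) * hPy

/-- The `U`-equation in Lemma-8.22 form: `3C/S - 2W/S³ - 3UC/S - 4Ss(s-S)/W = -2YS/W - UC/S + U²S/(2W)`. -/
theorem innerU_Yform (s U W S C : ℝ) (hW : W ≠ 0) (hS : S ≠ 0) :
    3 * C / S - 2 * W / S ^ 3 - 3 * U * C / S - 4 * S * s * (s - S) / W
      = -2 * (2 * s ^ 2 - 2 * s * S + U ^ 2 / 4 + U * W * C / S ^ 2 - 3 / 2 * W * C / S ^ 2 + W ^ 2 / S ^ 4) * S / W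
        - U * C / S + U ^ 2 * S / (2 * W) := by
  field_simp
  ring

/-- `Y' = 2s²US/W - (3/2)εW/S + εUW/S - (3/2)WC²/S³ - (9/4)(U-1)C/S` (the left side is the product-rule expansion of `Y'`). -/
theorem innerY_deriv (s U W S C ε ds dU dW dS dC : ℝ) (hW : W ≠ 0) (hS : S ≠ 0) (hPy : ε * S ^ 2 + C ^ 2 = 1)
    (hds : ds = s * (U * S / W + C / S))
    (hdU : dU = -2 * (2 * s ^ 2 - 2 * s * S + U ^ 2 / 4 + U * W * C / S ^ 2 - 3 / 2 * W * C / S ^ 2 + W ^ 2 / S ^ 4) * S / W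
                  - U * C / S + U ^ 2 * S / (2 * W))
    (hdW : dW = (3 * W * C + 3 / 2 * S ^ 2 * (U - 1)) / S) (hdS : dS = C) (hdC : dC = -ε * S) :
    (4 * s - 2 * S) * ds - 2 * s * dS + U * dU / 2 + dU * W * C / S ^ 2
        + U * (dW * C / S ^ 2 + W * dC / S ^ 2 - 2 * W * C * dS / S ^ 3)
        - 3 / 2 * (dW * C / S ^ 2 + W * dC / S ^ 2 - 2 * W * C * dS / S ^ 3) + 2 * W * dW / S ^ 4 - 4 * W ^ 2 * dS / S ^ 5
      = 2 * s ^ 2 * U * S / W - 3 / 2 * ε * W / S + ε * U * W / S - 3 / 2 * W * C ^ 2 / S ^ 3 - 9 / 4 * (U - 1) * C / S := by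
  have hε : ε = (1 - C ^ 2) / S ^ 2 := by
    rw [eq_div_iff (pow_ne_zero 2 hS)]; linarith
  subst hds hdU hdW hdS hdC
  rw [hε]
  field_simp
  ring

/-- LEMMA 8.34 (slow-manifold energy identity). For any comparison values `Uc, Yc, sc` with assigned rates `gU, gY`:
`d/dt[s²(U-Uc)² + (Y-Yc)²] = s²S(3U+Uc)(U-Uc)²/W + 2(Y-Yc)(U-Uc)(εW/S - (9/4)C/S) + 4 S Uc (s² - sc²)(Y-Yc)/W
  - 2s²(U-Uc)(gU - F_U(Uc,Yc)) - 2(Y-Yc)(gY - F_Y(Uc,sc))`; no cross term `(U-Uc)(Y-Yc)S/W`, no adiabatic term `(C/S)s²(U-Uc)²`. -/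
theorem innerEnergy_identity (s U Y W S C ε Uc Yc sc gU gY ds dU dY : ℝ) (hW : W ≠ 0) (hS : S ≠ 0)
    (hds : ds = s * (U * S / W + C / S))
    (hdU : dU = -2 * Y * S / W - U * C / S + U ^ 2 * S / (2 * W))
    (hdY : dY = 2 * s ^ 2 * U * S / W - 3 / 2 * ε * W / S + ε * U * W / S - 3 / 2 * W * C ^ 2 / S ^ 3
                  - 9 / 4 * (U - 1) * C / S) :
    2 * s * ds * (U - Uc) ^ 2 + 2 * s ^ 2 * (U - Uc) * (dU - gU) + 2 * (Y - Yc) * (dY - gY)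
      = s ^ 2 * S * (3 * U + Uc) * (U - Uc) ^ 2 / W + 2 * (Y - Yc) * (U - Uc) * (ε * W / S - 9 / 4 * C / S)
        + 4 * S * Uc * (s ^ 2 - sc ^ 2) * (Y - Yc) / W
        - 2 * s ^ 2 * (U - Uc) * (gU - (-2 * Yc * S / W - Uc * C / S + Uc ^ 2 * S / (2 * W)))
        - 2 * (Y - Yc) * (gY - (2 * sc ^ 2 * Uc * S / W - 3 / 2 * ε * W / S + ε * Uc * W / S
                            - 3 / 2 * W * C ^ 2 / S ^ 3 - 9 / 4 * (Uc - 1) * C / S)) := by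
  subst hds hdU hdY
  field_simp
  ring

/-- First slaving step. With `r := W(3C/S - 2W/S³)/(4S³) = 3WC/(4S⁴) - W²/(2S⁶)`, `∂_t r = -3εW/(4S³) - 3WC²/S⁵ + 3W²C/S⁷`
(`S' = C`, `C' = -εS`) and `∂_W r = 3C/(4S⁴) - W/S⁶`, the slaved derivative along `W' = 3WC/S - 3S/2` is `-3 G̃/(8S²)`. -/
theorem slowManifold_Dr (W S C ε : ℝ) (hS : S ≠ 0) (hPy : ε * S ^ 2 + C ^ 2 = 1) :
    -3 * ε * W / (4 * S ^ 3) - 3 * W * C ^ 2 / S ^ 5 + 3 * W ^ 2 * C / S ^ 7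
        + (3 * W * C / S - 3 / 2 * S) * (3 * C / (4 * S ^ 4) - W / S ^ 6)
      = -(3 / (8 * S ^ 2)) * (3 * C / S - 2 * W / S ^ 3) := by
  have hε : ε = (1 - C ^ 2) / S ^ 2 := by
    rw [eq_div_iff (pow_ne_zero 2 hS)]; linarith
  rw [hε]
  field_simp
  ring

/-- The slow flux `W_sl := (3/2) S² (C - η S)` solves `W' = 3WC/S - 3S/2` (`η = C/S` at the cone, where `W_sl = 0`). -/
theorem slowW_solves (S C ε η dS dC : ℝ) (hS : S ≠ 0) (hPy : ε * S ^ 2 + C ^ 2 = 1) (hdS : dS = C) (hdC : dC = -ε * S) :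
    3 / 2 * (2 * S * dS * (C - η * S) + S ^ 2 * (dC - η * dS))
      = 3 * (3 / 2 * S ^ 2 * (C - η * S)) * C / S - 3 / 2 * S := by
  have hε : ε = (1 - C ^ 2) / S ^ 2 := by
    rw [eq_div_iff (pow_ne_zero 2 hS)]; linarith
  subst hdS hdC
  rw [hε]
  field_simp
  ring

end Summit.NavierStokesRegularity.NavierStokesRegularity.Theorems
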